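import Literature.Geometry.Lorentzian.CoordCurvatureLaplacian
import HarnessLib

/-!
# The Ricci tensor of metric components in wave (harmonic) gauge form: the reduced Einstein
# operator `−½ gⁱʲ ∂ᵢ∂ⱼ g` plus the symmetrised derivative of the contracted Christoffel symbols

Coordinate tensor calculus (namespace `MetricCoord`, `CoordCurvature.lean` ff.: components
`G : E → (E →L E →L ℝ)` of a pseudo-Riemannian metric, smooth, symmetric and nondegenerate on an
open set `V` — `IsMetricOn G V` — with Christoffel map `chrAt`, curvature `riemAt`, Ricci form
`ricAt`, inverse coefficients `ginv G b x i j = gⁱʲ` in a basis `b`). For such `G`, a basis `b` of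
`E` and `x ∈ V` we prove **the decomposition of the Ricci tensor used to write the Einstein
equations as a quasilinear wave system** (Hawking–Ellis 1973, §7.5, (7.42)–(7.46); the classical
"`R_{ab} = −½ g^{cd} ∂_c∂_d g_{ab} + ∂_{(a}Γ_{b)} + H_{ab}(g, ∂g)`", e.g. Ringström 2009, §14;
Choquet-Bruhat 2009, VI.7):

  `Ric_x(Y, Z) = −½ Σᵢⱼ gⁱʲ ∂_{bᵢ}∂_{bⱼ} G (Y, Z) + ½ (∂_Y Γ♭(·, Z) + ∂_Z Γ♭(·, Y))(x)
                  + ricRem b (G x) (DG x) Y Z`                     (`IsMetricOn.ricAt_eq_waveGauge`)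

where `Γ♭(x, W) = Σᵢⱼ gⁱʲ G_x(Γ(bᵢ, bⱼ), W)` (`gaugeFun`, the contracted Christoffel symbols
lowered with the metric — `Γ♭ ≡ 0` on an open set exactly when the coordinates `bⁱ` are
`g`-harmonic there, `□_g bⁱ = −Σ gʲᵏ Γⁱ_{jk}`) and the remainder `ricRem b B T Y Z` is an explicit
polynomial expression in the *pointwise* data `B = G x`, `B⁻¹` and `T = DG x` only
(no second derivatives): `Σ gⁱʲ (G(Γ(bᵢ,Z), Γ(Y,bⱼ)) − G(Γ(Y,Z), Γ(bᵢ,bⱼ)))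
 + ½ Σᵢⱼ (Σ_{cd} gⁱᶜ ∂_Y G(b_c,b_d) gᵈʲ) G(Γ(bᵢ,bⱼ), Z) + (Y ↔ Z)`.
Consequently (`IsMetricOn.ricAt_eq_of_gaugeFun_eq_zero`), **in wave gauge** (`Γ♭ = 0` on an open
subset) the vacuum equations `Ric = 0` read `½ Σ gⁱʲ ∂ᵢ∂ⱼ G(Y,Z) = ricRem (G x) (DG x) Y Z`, a
quasilinear diagonal second-order system for the components — the reduced empty space Einstein
equations — whose right-hand side is a smooth function of the `1`-jet at nondegenerate jets
(`contDiffAt_ricRem`).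

Proof: `Ric(Y,Z) = Σ gⁱʲ G(R(bᵢ,Y)Z, bⱼ)` (`ricAt_eq_sum_ginv`) with the first-kind formula
`G(R(X,Y)Z,W) = ½(∂_X K(Y,Z,W) − ∂_Y K(X,Z,W)) − G(Γ(Y,Z),Γ(X,W)) + G(Γ(X,Z),Γ(Y,W))`
(`IsMetricOn.apply_riemAt`), the derivative of the Koszul form through `D²G`
(`fderiv_koszulCLM_apply₃`), the derivative of `gⁱʲ` (`fderiv_ginv`) and the symmetries of `D²G`
and `gⁱʲ`; the second-order terms other than `−½ gⁱʲ∂ᵢ∂ⱼG(Y,Z)` are exactly those of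
`½(∂_YΓ♭_Z + ∂_ZΓ♭_Y)`. Everything is proved; no definitions of `Prop` type.

## References

* S. W. Hawking, G. F. R. Ellis, *The large scale structure of space-time*, CUP 1973, §7.5,
  (7.42)–(7.46). [HawkingEllis1973CUP]
* B. O'Neill, *Semi-Riemannian geometry*, 1983, Ch. 3, Prop. 3.13, Lemma 3.38, Lemma 3.52. [ONeill1983]
-/

noncomputable section

set_option maxSynthPendingDepth 3

open Set Filter ContinuousLinearMap Module
open scoped Topology ContDiff

namespace Literature.Geometry.Lorentzian

namespace MetricCoord

variable {E : Type*} [NormedAddCommGroup E] [NormedSpace ℝ E]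

/-! ### Pointwise (jet) versions of `♯`, `gⁱʲ`, `Γ` and the remainder -/

section Pointwise

variable {ι : Type*} [Fintype ι] [FiniteDimensional ℝ E] (b : Basis ι ℝ E)

/-- Index raising for a single bilinear form `B`: `B⁻¹ : E* → E` (`sharpAt G x = sharpOf (G x)`).
[cite: ONeill1983, Ch. 3, p. 60] -/
def sharpOf (B : E →L[ℝ] E →L[ℝ] ℝ) : (E →L[ℝ] ℝ) →L[ℝ] E :=
  B.inverse

/-- Inverse coefficients of a single bilinear form in the basis `b` (`ginv G b x = ginvOf b (G x)`).
[cite: ONeill1983, Ch. 3, p. 60] -/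
def ginvOf (B : E →L[ℝ] E →L[ℝ] ℝ) (i j : ι) : ℝ :=
  b.coord i (sharpOf B (coordCLM b j))

/-- The Christoffel map as a function of the `1`-jet `(B, T) = (G x, DG x)`
(`chrAt G x = chrOf (G x) (fderiv ℝ G x)`). [cite: ONeill1983, Ch. 3, Prop. 3.13] -/
def chrOf (B : E →L[ℝ] E →L[ℝ] ℝ) (T : E →L[ℝ] E →L[ℝ] E →L[ℝ] ℝ) : E →L[ℝ] E →L[ℝ] E :=
  (2⁻¹ : ℝ) • ((ContinuousLinearMap.compL ℝ E (E →L[ℝ] ℝ) E (sharpOf B)).comp (koszulOp T))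

/-- **The first-order remainder of the wave-gauge decomposition of the Ricci tensor**, as a
function of the `1`-jet `(B, T) = (G x, DG x)`:
`Σ gⁱʲ (B(Γ(bᵢ,Z), Γ(Y,bⱼ)) − B(Γ(Y,Z), Γ(bᵢ,bⱼ))) + ½ Σᵢⱼ (Σ_{cd} gⁱᶜ T(Y)(b_c,b_d) gᵈʲ) B(Γ(bᵢ,bⱼ), Z)
 + ½ Σᵢⱼ (Σ_{cd} gⁱᶜ T(Z)(b_c,b_d) gᵈʲ) B(Γ(bᵢ,bⱼ), Y)`. [cite: HawkingEllis1973CUP, §7.5 (7.45)–(7.46)] -/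
def ricRem (B : E →L[ℝ] E →L[ℝ] ℝ) (T : E →L[ℝ] E →L[ℝ] E →L[ℝ] ℝ) (Y Z : E) : ℝ :=
  ∑ i, ∑ j, ginvOf b B i j *
      (B (chrOf B T (b i) Z) (chrOf B T Y (b j)) - B (chrOf B T Y Z) (chrOf B T (b i) (b j))) +
    2⁻¹ * ∑ i, ∑ j, (∑ c, ∑ d, ginvOf b B i c * T Y (b c) (b d) * ginvOf b B d j) *
      B (chrOf B T (b i) (b j)) Z +
    2⁻¹ * ∑ i, ∑ j, (∑ c, ∑ d, ginvOf b B i c * T Z (b c) (b d) * ginvOf b B d j) *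
      B (chrOf B T (b i) (b j)) Y

variable (G : E → E →L[ℝ] E →L[ℝ] ℝ) (x : E)

omit [Fintype ι] [FiniteDimensional ℝ E] in
/-- `sharpAt G x = sharpOf (G x)`. [folklore] -/
theorem sharpAt_eq_sharpOf : sharpAt G x = sharpOf (G x) := rfl

omit [Fintype ι] in
/-- `ginv G b x i j = ginvOf b (G x) i j`. [folklore] -/
theorem ginv_eq_ginvOf (i j : ι) : ginv G b x i j = ginvOf b (G x) i j := rfl

omit [Fintype ι] [FiniteDimensional ℝ E] in
/-- `chrAt G x = chrOf (G x) (DG x)`. [folklore] -/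
theorem chrAt_eq_chrOf : chrAt G x = chrOf (G x) (fderiv ℝ G x) := rfl

/-- **The contracted Christoffel symbols, lowered** (`Γ♭`): `gaugeFun G b x W =
Σᵢⱼ gⁱʲ · ½ K_x(bᵢ, bⱼ, W)` (`= Σᵢⱼ gⁱʲ G_x(Γ(bᵢ,bⱼ), W)` where `G x` is invertible,
`gaugeFun_eq`). Its vanishing on an open set is the wave (harmonic) coordinate condition
`□_g bⁱ = 0`. [cite: HawkingEllis1973CUP, §7.5 (7.42), (7.51)] -/
def gaugeFun (W : E) : ℝ :=
  ∑ i, ∑ j, ginv G b x i j * (2⁻¹ * koszulCLM G x (b i) (b j) W)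

variable {G x}

/-- `Γ♭(W) = Σᵢⱼ gⁱʲ G(Γ(bᵢ,bⱼ), W)` at points where `G x` is invertible. [folklore] -/
theorem gaugeFun_eq (hx : (G x).IsInvertible) (W : E) :
    gaugeFun b G x W = ∑ i, ∑ j, ginv G b x i j * G x (chrAt G x (b i) (b j)) W := by
  unfold gaugeFun
  simp only [apply_chrAt hx]

end Pointwise

/-! ### The derivative of `Γ♭` -/

section GaugeDeriv

variable {ι : Type*} [Fintype ι] [FiniteDimensional ℝ E] [CompleteSpace E] (b : Basis ι ℝ E)
  {G : E → E →L[ℝ] E →L[ℝ] ℝ} {V : Set E} {x : E}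

/-- **Derivative of the contracted Christoffel symbols**:
`∂_v Γ♭(·, W)(x) = Σᵢⱼ [(−Σ_{cd} gⁱᶜ ∂_vG(b_c,b_d) gᵈʲ) G(Γ(bᵢ,bⱼ),W)
  + gⁱʲ · ½ (D²G(v,bᵢ)(bⱼ,W) + D²G(v,bⱼ)(W,bᵢ) − D²G(v,W)(bᵢ,bⱼ))]`. [folklore] -/
theorem IsMetricOn.fderiv_gaugeFun (hG : IsMetricOn G V) (hx : x ∈ V) (W v : E) :
    fderiv ℝ (fun y ↦ gaugeFun b G y W) x v =
      ∑ i, ∑ j, ((-∑ c, ∑ d, ginv G b x i c * fderiv ℝ G x v (b c) (b d) * ginv G b x d j) *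
          G x (chrAt G x (b i) (b j)) W +
        ginv G b x i j * (2⁻¹ * (fderiv ℝ (fderiv ℝ G) x v (b i) (b j) W +
          fderiv ℝ (fderiv ℝ G) x v (b j) W (b i) - fderiv ℝ (fderiv ℝ G) x v W (b i) (b j)))) := by
  have hi := hG.isInvertible x hx
  have hdg : ∀ i j, DifferentiableAt ℝ (fun y ↦ ginv G b y i j) x := fun i j ↦
    ((hG.contDiffOn_ginv b i j x hx).contDiffAt (hG.mem_nhds hx)).differentiableAt (by simp)
  have hdk : ∀ i j, DifferentiableAt ℝ (fun y ↦ 2⁻¹ * koszulCLM G y (b i) (b j) W) x := fun i j ↦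
    (hG.differentiableAt_koszulCLM_apply₃ hx _ _ _).const_mul _
  have hdt : ∀ i j, DifferentiableAt ℝ
      (fun y ↦ ginv G b y i j * (2⁻¹ * koszulCLM G y (b i) (b j) W)) x := fun i j ↦
    (hdg i j).mul (hdk i j)
  unfold gaugeFun
  rw [fderiv_fun_sum fun i _ ↦ DifferentiableAt.fun_sum fun j _ ↦ hdt i j]
  simp only [FunLike.coe_sum, Finset.sum_apply]
  refine Finset.sum_congr rfl fun i _ ↦ ?_
  rw [fderiv_fun_sum fun j _ ↦ hdt i j]
  simp only [FunLike.coe_sum, Finset.sum_apply]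
  refine Finset.sum_congr rfl fun j _ ↦ ?_
  rw [fderiv_fun_mul (hdg i j) (hdk i j)]
  simp only [_root_.add_apply, FunLike.coe_smul, Pi.smul_apply, smul_eq_mul]
  rw [fderiv_const_mul (hG.differentiableAt_koszulCLM_apply₃ hx _ _ _)]
  simp only [FunLike.coe_smul, Pi.smul_apply, smul_eq_mul]
  rw [hG.fderiv_koszulCLM_apply₃ hx, hG.fderiv_ginv b hx, apply_chrAt hi]
  ring

end GaugeDeriv

/-! ### The wave-gauge decomposition of the Ricci tensor -/

section WaveGauge

variable {ι : Type*} [Fintype ι] [FiniteDimensional ℝ E] [CompleteSpace E] (b : Basis ι ℝ E)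
  {G : E → E →L[ℝ] E →L[ℝ] ℝ} {V : Set E} {x : E}

omit [FiniteDimensional ℝ E] [CompleteSpace E] in
/-- Symmetrisation trick for double sums: `Σᵢⱼ fᵢⱼ = Σᵢⱼ hᵢⱼ` as soon as
`fᵢⱼ + fⱼᵢ = hᵢⱼ + hⱼᵢ`. [folklore] -/
theorem sum_sum_eq_of_add_swap {f h : ι → ι → ℝ} (H : ∀ i j, f i j + f j i = h i j + h j i) :
    ∑ i, ∑ j, f i j = ∑ i, ∑ j, h i j := by
  have hf : ∑ i, ∑ j, f j i = ∑ i, ∑ j, f i j := Finset.sum_comm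
  have hh : ∑ i, ∑ j, h j i = ∑ i, ∑ j, h i j := Finset.sum_comm
  have h2 : ∑ i, ∑ j, (f i j + f j i) = ∑ i, ∑ j, (h i j + h j i) :=
    Finset.sum_congr rfl fun i _ ↦ Finset.sum_congr rfl fun j _ ↦ H i j
  simp only [Finset.sum_add_distrib] at h2
  linarith

/-- **The Ricci tensor in wave-gauge form** (reduced Einstein operator plus gauge term plus
first-order remainder):
`Ric(Y,Z) = −½ Σ gⁱʲ ∂_{bᵢ}∂_{bⱼ}G(Y,Z) + ½(∂_YΓ♭(·,Z) + ∂_ZΓ♭(·,Y)) + ricRem (G x) (DG x) Y Z`.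
[cite: HawkingEllis1973CUP, §7.5 (7.44)–(7.46)] -/
theorem IsMetricOn.ricAt_eq_waveGauge (hG : IsMetricOn G V) (hx : x ∈ V) (Y Z : E) :
    ricAt G x Y Z =
      -(2⁻¹ * ∑ i, ∑ j, ginv G b x i j * fderiv ℝ (fderiv ℝ G) x (b i) (b j) Y Z) +
        2⁻¹ * (fderiv ℝ (fun y ↦ gaugeFun b G y Z) x Y + fderiv ℝ (fun y ↦ gaugeFun b G y Y) x Z) +
        ricRem b (G x) (fderiv ℝ G x) Y Z := by
  have hi := hG.isInvertible x hx
  have hs := hG.symm x hx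
  -- Step 0: the gauge derivatives (before introducing notation, so that it applies to them)
  have eGY := hG.fderiv_gaugeFun b hx Z Y
  have eGZ := hG.fderiv_gaugeFun b hx Y Z
  -- notation
  set g : ι → ι → ℝ := ginv G b x with hg
  set Γ : E →L[ℝ] E →L[ℝ] E := chrAt G x with hΓ
  set T : E →L[ℝ] E →L[ℝ] E →L[ℝ] ℝ := fderiv ℝ G x with hT
  set S : E →L[ℝ] E →L[ℝ] E →L[ℝ] E →L[ℝ] ℝ := fderiv ℝ (fderiv ℝ G) x with hS
  have hgs : ∀ i j, g j i = g i j := fun i j ↦ (ginv_comm b hi hs i j).symm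
  have hS1 : ∀ u v, S u v = S v u := fun u v ↦ hG.fderiv_fderiv_comm hx u v
  have hS2 : ∀ u v A B, S u v A B = S u v B A := fun u v A B ↦ hG.fderiv_fderiv_symm hx u v A B
  -- Step 1: the Ricci tensor through the first-kind curvature formula
  have eRic : ricAt G x Y Z = ∑ i, ∑ j, g i j *
      (2⁻¹ * ((S (b i) Y Z (b j) + S (b i) Z (b j) Y - S (b i) (b j) Y Z) -
          (S Y (b i) Z (b j) + S Y Z (b j) (b i) - S Y (b j) (b i) Z)) -
        G x (Γ Y Z) (Γ (b i) (b j)) + G x (Γ (b i) Z) (Γ Y (b j))) := by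
    rw [ricAt_eq_sum_ginv b hi]
    refine Finset.sum_congr rfl fun i _ ↦ Finset.sum_congr rfl fun j _ ↦ ?_
    rw [hG.apply_riemAt hx, hG.fderiv_koszulCLM_apply₃ hx, hG.fderiv_koszulCLM_apply₃ hx]
  -- Step 2: the remainder in terms of `g`, `Γ`, `T`
  have eRem : ricRem b (G x) (fderiv ℝ G x) Y Z =
      ∑ i, ∑ j, g i j * (G x (Γ (b i) Z) (Γ Y (b j)) - G x (Γ Y Z) (Γ (b i) (b j))) +
        2⁻¹ * ∑ i, ∑ j, (∑ c, ∑ d, g i c * T Y (b c) (b d) * g d j) * G x (Γ (b i) (b j)) Z +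
        2⁻¹ * ∑ i, ∑ j, (∑ c, ∑ d, g i c * T Z (b c) (b d) * g d j) * G x (Γ (b i) (b j)) Y := rfl
  rw [eRic, eGY, eGZ, eRem]
  -- Step 3: collect everything into double sums and compare summands up to `i ↔ j`
  simp only [Finset.mul_sum, ← Finset.sum_add_distrib, ← Finset.sum_neg_distrib]
  refine sum_sum_eq_of_add_swap fun i j ↦ ?_
  -- normal forms of the second derivatives (first pair and second pair sorted) and of `g`
  simp only [hS1 Y (b i), hS1 Z (b i), hS1 Y (b j), hS1 Z (b j), hS1 Z Y, hS1 (b j) (b i),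
    hS2 _ _ Z (b i), hS2 _ _ Z (b j), hS2 _ _ Y (b i), hS2 _ _ Y (b j),
    hS2 _ _ (b j) (b i), hgs, Finset.sum_neg_distrib, neg_mul]
  ring

/-- **The vacuum Einstein equations in wave gauge.** If the contracted Christoffel symbols vanish
on an open set `U ⊆ V` (wave / harmonic coordinates), then on `U`:
`Ric(Y,Z) = −½ Σ gⁱʲ ∂ᵢ∂ⱼ G(Y,Z) + ricRem (G x) (DG x) Y Z`; in particular `Ric = 0` is the
quasilinear diagonal second-order system `½ Σ gⁱʲ ∂ᵢ∂ⱼ G(Y,Z) = ricRem (G x) (DG x) Y Z` for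
the components (the reduced empty space Einstein equations). [cite: HawkingEllis1973CUP, §7.5 (7.44)–(7.46)] -/
theorem IsMetricOn.ricAt_eq_of_gaugeFun_eq_zero (hG : IsMetricOn G V) {U : Set E} (hU : IsOpen U)
    (hUV : U ⊆ V) (hgauge : ∀ y ∈ U, ∀ W, gaugeFun b G y W = 0) (hx : x ∈ U) (Y Z : E) :
    ricAt G x Y Z =
      -(2⁻¹ * ∑ i, ∑ j, ginv G b x i j * fderiv ℝ (fderiv ℝ G) x (b i) (b j) Y Z) +
        ricRem b (G x) (fderiv ℝ G x) Y Z := by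
  have h0 : ∀ W, fderiv ℝ (fun y ↦ gaugeFun b G y W) x = 0 := fun W ↦ by
    have hev : (fun y ↦ gaugeFun b G y W) =ᶠ[𝓝 x] fun _ ↦ 0 :=
      Filter.eventually_of_mem (hU.mem_nhds hx) fun y hy ↦ hgauge y hy W
    rw [hev.fderiv_eq, fderiv_fun_const]
    rfl
  rw [hG.ricAt_eq_waveGauge b (hUV hx) Y Z, h0 Z, h0 Y]
  simp

end WaveGauge

/-! ### Smoothness of the remainder in the `1`-jet -/

section RemSmooth

variable {ι : Type*} [Fintype ι] [FiniteDimensional ℝ E] [CompleteSpace E] (b : Basis ι ℝ E)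

omit [FiniteDimensional ℝ E] in
/-- The Christoffel map is a smooth function of the `1`-jet `(B, T)` at invertible `B`. [folklore] -/
theorem contDiffAt_chrOf {B₀ : E →L[ℝ] E →L[ℝ] ℝ} (hB₀ : B₀.IsInvertible)
    (T₀ : E →L[ℝ] E →L[ℝ] E →L[ℝ] ℝ) :
    ContDiffAt ℝ ∞ (fun BT : (E →L[ℝ] E →L[ℝ] ℝ) × (E →L[ℝ] E →L[ℝ] E →L[ℝ] ℝ) ↦ chrOf BT.1 BT.2)
      (B₀, T₀) := by
  have hinv : ContDiffAt ℝ ∞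
      (fun BT : (E →L[ℝ] E →L[ℝ] ℝ) × (E →L[ℝ] E →L[ℝ] E →L[ℝ] ℝ) ↦ sharpOf BT.1) (B₀, T₀) :=
    hB₀.contDiffAt_map_inverse.comp _ contDiffAt_fst
  have h1 : ContDiffAt ℝ ∞ (fun BT : (E →L[ℝ] E →L[ℝ] ℝ) × (E →L[ℝ] E →L[ℝ] E →L[ℝ] ℝ) ↦
      ContinuousLinearMap.compL ℝ E (E →L[ℝ] ℝ) E (sharpOf BT.1)) (B₀, T₀) :=
    (ContinuousLinearMap.compL ℝ E (E →L[ℝ] ℝ) E).contDiff.contDiffAt.comp _ hinv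
  have h2 : ContDiffAt ℝ ∞ (fun BT : (E →L[ℝ] E →L[ℝ] ℝ) × (E →L[ℝ] E →L[ℝ] E →L[ℝ] ℝ) ↦
      koszulOp BT.2) (B₀, T₀) :=
    (koszulOp (E := E)).contDiff.contDiffAt.comp _ contDiffAt_snd
  unfold chrOf
  exact (h1.clm_comp h2).const_smul _

omit [Fintype ι] in
/-- The inverse coefficients are smooth functions of `B` at invertible `B`. [folklore] -/
theorem contDiffAt_ginvOf {B₀ : E →L[ℝ] E →L[ℝ] ℝ} (hB₀ : B₀.IsInvertible)
    (T₀ : E →L[ℝ] E →L[ℝ] E →L[ℝ] ℝ) (i j : ι) :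
    ContDiffAt ℝ ∞ (fun BT : (E →L[ℝ] E →L[ℝ] ℝ) × (E →L[ℝ] E →L[ℝ] E →L[ℝ] ℝ) ↦ ginvOf b BT.1 i j)
      (B₀, T₀) := by
  have hinv : ContDiffAt ℝ ∞
      (fun BT : (E →L[ℝ] E →L[ℝ] ℝ) × (E →L[ℝ] E →L[ℝ] E →L[ℝ] ℝ) ↦ sharpOf BT.1) (B₀, T₀) :=
    hB₀.contDiffAt_map_inverse.comp _ contDiffAt_fst
  unfold ginvOf
  exact (coordCLM b i).contDiff.contDiffAt.comp _ (hinv.clm_apply contDiffAt_const)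

/-- **The remainder `ricRem` is a smooth function of the `1`-jet `(B, T)` at invertible `B`** (so
that the reduced Einstein equations are a quasilinear system with smooth coefficients on the open
set of nondegenerate jets). [folklore] -/
theorem contDiffAt_ricRem {B₀ : E →L[ℝ] E →L[ℝ] ℝ} (hB₀ : B₀.IsInvertible)
    (T₀ : E →L[ℝ] E →L[ℝ] E →L[ℝ] ℝ) (Y Z : E) :
    ContDiffAt ℝ ∞ (fun BT : (E →L[ℝ] E →L[ℝ] ℝ) × (E →L[ℝ] E →L[ℝ] E →L[ℝ] ℝ) ↦
      ricRem b BT.1 BT.2 Y Z) (B₀, T₀) := by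
  have hginv := contDiffAt_ginvOf b hB₀ T₀
  have hchr := contDiffAt_chrOf hB₀ T₀
  have hchr2 : ∀ u v, ContDiffAt ℝ ∞
      (fun BT : (E →L[ℝ] E →L[ℝ] ℝ) × (E →L[ℝ] E →L[ℝ] E →L[ℝ] ℝ) ↦ chrOf BT.1 BT.2 u v) (B₀, T₀) :=
    fun u v ↦ (hchr.clm_apply contDiffAt_const).clm_apply contDiffAt_const
  have happ : ∀ {f g : (E →L[ℝ] E →L[ℝ] ℝ) × (E →L[ℝ] E →L[ℝ] E →L[ℝ] ℝ) → E},
      ContDiffAt ℝ ∞ f (B₀, T₀) → ContDiffAt ℝ ∞ g (B₀, T₀) →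
      ContDiffAt ℝ ∞ (fun BT : (E →L[ℝ] E →L[ℝ] ℝ) × (E →L[ℝ] E →L[ℝ] E →L[ℝ] ℝ) ↦
        BT.1 (f BT) (g BT)) (B₀, T₀) :=
    fun hf hg ↦ (contDiffAt_fst.clm_apply hf).clm_apply hg
  have hT : ∀ u v w, ContDiffAt ℝ ∞
      (fun BT : (E →L[ℝ] E →L[ℝ] ℝ) × (E →L[ℝ] E →L[ℝ] E →L[ℝ] ℝ) ↦ BT.2 u v w) (B₀, T₀) :=
    fun u v w ↦ ((contDiffAt_snd.clm_apply contDiffAt_const).clm_apply contDiffAt_const).clm_apply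
      contDiffAt_const
  unfold ricRem
  refine ((ContDiffAt.sum fun i _ ↦ ContDiffAt.sum fun j _ ↦ (hginv i j).mul
    ((happ (hchr2 _ _) (hchr2 _ _)).sub (happ (hchr2 _ _) (hchr2 _ _)))).add
    (contDiffAt_const.mul (ContDiffAt.sum fun i _ ↦ ContDiffAt.sum fun j _ ↦
      (ContDiffAt.sum fun c _ ↦ ContDiffAt.sum fun d _ ↦
        ((hginv i c).mul (hT _ _ _)).mul (hginv d j)).mul (happ (hchr2 _ _) contDiffAt_const)))).add
    (contDiffAt_const.mul (ContDiffAt.sum fun i _ ↦ ContDiffAt.sum fun j _ ↦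
      (ContDiffAt.sum fun c _ ↦ ContDiffAt.sum fun d _ ↦
        ((hginv i c).mul (hT _ _ _)).mul (hginv d j)).mul (happ (hchr2 _ _) contDiffAt_const)))

end RemSmooth

end MetricCoord

end Literature.Geometry.Lorentzian
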